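import Summits.HodgeConjecture.HodgeConjecture.Theorems.Ring2HypothesesWeilComponents
import Summits.HodgeConjecture.HodgeConjecture.Theorems.Ring2TransportWeilTypeGeneralCMFieldSU
import Literature.AlgebraicGeometry.Deligne1982.WeilTypeCMDiscriminant
import HarnessLib

/-!
# Ring 2 — hypotheses layer, part VII-C: Weil class targets and transport inputs indexed by `(E, d = 2k, δ = disc φ)`, `E` a CM field with `[E:ℚ] = 2e₀ ≥ 4`

HONEST FRAMING: research route conditional on HC_CM; not a corollary; Q11.4-sentence-2 already refuted in dim ≥ 3.

Cell `pub-hodge-ring2`, seat `pub-hodge-ring2-typer2`, gen 7. `HC_CM` is ALWAYS the binder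
`(hCM : Theses.RankFourFaces.CMAbelianHodge)` (stmt-HodgeConjecture-3052), never an axiom, never cited as known.
Every `@[conjecture] def` below is a TYPED TARGET or a TYPED MISSING INPUT (a named open hypothesis); every theorem is
a kernel-checked implication between them. Nothing internally minted is cited as a fact; unrefereed inputs are labelled.

## What this file adds (RING2-MAP §hypotheses gen 5 item 5 (i), gen 6 "next gen" (2); first consumer of `Deligne1982.HasWeilDiscriminantCM`)

Part VII-A/B index Weil's question for IMAGINARY QUADRATIC `K` by van Geemen's third invariant `δ = det H ∈ ℚˣ/Nm(Kˣ)`.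
For a CM field `E` with `[E:ℚ] = 2e₀ > 2` (rung R3, the case Markman's survey §12 leaves open) the invariant is
Deligne's discriminant `disc φ ∈ Fˣ/Nm_{E/F}(Eˣ)`, `F = E⁺` (LNM 900 §4 p. 30 (1), Lemma 4.6; Landherr), typed by the
literature seat on Deligne's real carriers as `HasWeilDiscriminantCM A η R e₀ k h δ` (`E = ℚ(η) ≅ ℚ[T]/(R(T²))`,
`δ : cmNormResidueGroup R = Fˣ ⧸ Nm(Eˣ)`). This file is the CM-field twin of part VII-A on those carriers:

* `WeilClassesWeilTypeCM` — rung R3 rendered on Deligne's carriers (`IsWeilTypeCM A η R e₀ k`, `e₀ ≥ 2`): a SLICE of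
  R3 (`weilClassesWeilTypeCM_of_weilClassesCMField`, via the transport seat's junction lemma); ON-PATH.
* `WeilClassesComponentCM R e₀ k δ` — the CLASS TARGET of the component `(E, 2k, δ)`: for `(A, η)` of Weil type with a
  polarization class `h` whose Rosati involution is complex conjugation on `E` and `disc = δ`, every rational `(k,k)`
  class of `W_E ⊗ ℂ = weilClassesField A η R(T²) (2k)` is algebraic; `WeilClassesByComponentCM` — all of them.
* `HasWeilChartsOfDiscCM`, `WeilVariationalHodgeComponentCM` (δ-restricted Weil-confined VHC; a case of the summit,
  WEAKER than R3var's slice), `PointedWeilFamiliesComponentCM … anchor` with the CM / algebraic / divisor-generated-CM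
  anchors of VII-A made dimension-generic (`cmAnchorOfDim`, `divisorGeneratedCMAnchorOfDim`; `rfl`-dictionary to VII-A).
* Rows: the ANCHOR ENGINE; W1-CM `weilClassesComponentCM_of_HC_CM` (`HC_CM` + CM-pointed δ-families + δ-VHC);
  W1′-CM `HC_CM`-free from a divisor-generated CM fibre; the anchored row; the typed supply statement
  `PolarizedWeilDiscriminantCMExists` (Deligne p. 30 (1), Lemma 4.6 with Thm. 4.8 (a); kept `[status: open]`, never
  asserted) and the T6(δ)-CM target `HodgeGeneralWeilTypeComponentCM` (general member of the component). The ON-PATH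
  lemmas, the slices of R3 / R3var / T6-CM, the EXACTNESS `WeilClassesWeilTypeCM ↔ WeilClassesByComponentCM` granted the
  supply statement, and the T6(δ)-CM rows (via fact #24, Moonen–Zarhin and the descent THEOREM
  `HodgeTheory.weilClassesField_le_span_isRationalClass`) are in the companion part VII-D
  (`Ring2HypothesesWeilComponentsCMLadder`).

Honest column. `HC_CM` is NOMINAL on every row here (W1′-CM). The content of each row is the δ-restricted
Weil-confined variational Hodge statement (OPEN; Charles–Schnell Conj. 11.3.1) — known in print for NO component with
`e₀ ≥ 2`. EMPTY / SIGN CONSTRAINTS (`sign(τ f) = (-1)^{b_τ}`, Deligne (1)) are not known to the carriers and not used.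
The CM-pointed supply leaves are family-supply hypotheses met in print (Deligne §5, Mumford 1969 §3), NOT consequences
of HC, hence without on-path lemma.

## References

* [Deligne1982HodgeCycles] P. Deligne, LNM 900 (1982), §4: p. 30 (1), Prop. 4.1, Cor. 4.2, (4.4), Lemma 4.6, Thm. 4.8
  and its proof (a)–(c), §5; Milne's 2003 re-edition endnote 16 (UNREFEREED for `[E:ℚ] > 2`).
* [MoonenZarhin1998WeilClasses] B. Moonen, Yu. Zarhin, Crelle 496 (1998), §1 (W_F, Criterion).
* [Landherr1936HermitianForms] W. Landherr, Abh. Math. Sem. Hamburg 11 (1936) (through Deligne Prop. 4.1).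
* [CharlesSchnell2014Notes] Conj. 11.3.1, Cor. 11.3.6. [Mumford1969NoteShimura] §3. [Milne1999] §7.
* [Markman2025SurveySecant] E. Markman, arXiv:2509.23403 §12 (UNREFEREED). [Deligne2000] §1.
-/

set_option linter.dupNamespace false

noncomputable section

open CategoryTheory
open Literature.AlgebraicGeometry Literature.AlgebraicGeometry.Motives
open Literature.AlgebraicGeometry.HodgeTheory
open Literature.AlgebraicGeometry.Deligne1982
open Literature.AlgebraicTopology.SingularHomology
open Literature.AlgebraicGeometry.Milne1999 (IsOfCMType)
open Literature.AlgebraicGeometry.VanGeemen1994 (pullbackOne)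
open Literature.Barriers.HodgeConjecture (divisorClassesSpan)
open Summit.HodgeConjecture.HodgeConjecture.WeilTypeLadder
open Summit.HodgeConjecture.HodgeConjecture.Theses
open Summit.HodgeConjecture.HodgeConjecture.Theorems (isSmoothProjectiveFamily_toSpecOver' isIso_fiberι_toSpecOver')
open Summit.HodgeConjecture.HodgeConjecture.Ring2Transport

namespace Summit.HodgeConjecture.HodgeConjecture.Ring2.Hypotheses

/-! ### §1 Rung R3 on Deligne's carriers, the `(E, 2k, δ)`-indexed class target, and the transport inputs -/

/-- **`WeilClassesWeilTypeCM` — rung R3 on Deligne's carriers (typed; a CASE of the summit).** For every Weil-type CM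
datum `(A, η, R, e₀, k)` (`IsWeilTypeCM`: `E = ℚ(η) ≅ ℚ[T]/(R(T²))` a CM field of degree `2e₀`, `η̄ = -η`,
`dim_E H¹ = 2k`, `a_σ = b_σ = k`) with `e₀ ≥ 2`, every RATIONAL `(k,k)` class of `W_E ⊗ ℂ = weilClassesField A η R(T²) (2k)`
is algebraic. A SLICE of R3 `WeilTypeLadder.WeilClassesCMField` (`weilClassesWeilTypeCM_of_weilClassesCMField`); OPEN
for every `E`; ON-PATH `weilClassesWeilTypeCM_of_hodgeConjecture`. [cite: Deligne1982HodgeCycles, §4 (4.4) and Prop. 4.4]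
[cite: MoonenZarhin1998WeilClasses, §1] [cite: Markman2025SurveySecant, §12 (preprint, unrefereed)] [status: open] -/
@[conjecture] def WeilClassesWeilTypeCM : Prop :=
  ∀ (A : AbelianVariety ℂ) (η : A ⟶ A) (R : Polynomial ℤ) (e₀ k : ℕ), 2 ≤ e₀ → IsWeilTypeCM A η R e₀ k →
    ∀ c ∈ weilClassesField A η (R.comp (Polynomial.X ^ 2)) (2 * k), IsRationalClass c →
      IsOfHodgeType A.dim A.X (2 * k) k k c → c ∈ algebraicClasses A.X k

section Indexed

variable (R : Polynomial ℤ) [Fact (Irreducible (realPolyQ R))] (e₀ k : ℕ) (δ : cmNormResidueGroup R)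

/-- **`WeilClassesComponentCM R e₀ k δ` — CLASS TARGET of the Weil-type component `(E = ℚ[T]/(R(T²)), d = 2k, disc = δ)`
(typed; a CASE of the summit).** For `(A, η)` of Weil type relative to `E` (`IsWeilTypeCM A η R e₀ k`), a polarization
class `h` whose Rosati involution induces complex conjugation on `E` (`Q_h(η^*x, y) = -Q_h(x, η^*y)`) and whose
Hermitian form has discriminant `disc φ = δ ∈ Fˣ/Nm_{E/F}(Eˣ)` (`HasWeilDiscriminantCM`, Deligne p. 30 (1) / Lemma 4.6),
every rational `(k,k)` class of `W_E ⊗ ℂ` is algebraic. Rung R3 cut down to ONE value of Landherr's invariant; OPEN for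
every component with `e₀ ≥ 2`; ON-PATH `weilClassesComponentCM_of_hodgeConjecture`.
[cite: Deligne1982HodgeCycles, §4 p. 30 (1), Prop. 4.1, Lemma 4.6] [cite: Landherr1936HermitianForms] [status: open] -/
@[conjecture] def WeilClassesComponentCM : Prop :=
  ∀ (A : AbelianVariety ℂ) (η : A ⟶ A) (h : complexBetti A.X 2), IsWeilTypeCM A η R e₀ k →
    IsPolarizationClass A.dim A.X h →
    (∀ x y : complexBetti A.X 1,
      polarizationPairingOne A.X h (A.dim - 1) (pullbackOne A η x) y =
        -polarizationPairingOne A.X h (A.dim - 1) x (pullbackOne A η y)) →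
    HasWeilDiscriminantCM A η R e₀ k h δ →
    ∀ c ∈ weilClassesField A η (R.comp (Polynomial.X ^ 2)) (2 * k), IsRationalClass c →
      IsOfHodgeType A.dim A.X (2 * k) k k c → c ∈ algebraicClasses A.X k

/-- **`HasWeilChartsOfDiscCM R e₀ k δ f W` — `f : 𝒳 ⟶ S` with global class `W` is an `(E, 2k, δ)`-Weil family**: every
complex fibre carries a chart `e′ : A′.X ≅ 𝒳_s` by a Weil-type CM datum `(A′, η′, R, e₀, k)` taking `W|_{𝒳_s}` into
`W_E ⊗ ℂ`, AND a Rosati-compatible polarization class of discriminant `δ`. In print: the universal family over a level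
cover of the connected component of Deligne's moduli of polarized abelian varieties of Weil type `(A, θ, ν)` (proof of
Thm. 4.8: "S a connected smooth variety, Y/S an abelian scheme with an action of E …"), on which `disc` is constant
(Landherr's invariants are locally constant in polarized families). [cite: Deligne1982HodgeCycles, §4 proof of Thm. 4.8 and Prop. 4.1] -/
def HasWeilChartsOfDiscCM {𝒳 S : SchemeOver ℂ} (f : 𝒳 ⟶ S) (W : complexBetti 𝒳 (2 * k)) : Prop :=
  ∀ s : ComplexPoints S, ∃ (A' : AbelianVariety ℂ) (η' : A' ⟶ A') (e' : A'.X ≅ fiberOver f s)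
      (h' : complexBetti A'.X 2),
    IsWeilTypeCM A' η' R e₀ k ∧
      complexBetti.map e'.hom (2 * k) (complexBetti.map (fiberι f s) (2 * k) W) ∈
        weilClassesField A' η' (R.comp (Polynomial.X ^ 2)) (2 * k) ∧
      IsPolarizationClass A'.dim A'.X h' ∧
      (∀ x y : complexBetti A'.X 1,
        polarizationPairingOne A'.X h' (A'.dim - 1) (pullbackOne A' η' x) y =
          -polarizationPairingOne A'.X h' (A'.dim - 1) x (pullbackOne A' η' y)) ∧
      HasWeilDiscriminantCM A' η' R e₀ k h' δ

/-- **`WeilVariationalHodgeComponentCM R e₀ k δ` — "VHC_instance ⟨Weil, E, 2k, δ⟩" (typed missing input; a CASE of the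
summit).** Along a smooth projective `(E, 2k, δ)`-Weil family of relative dimension `2k·e₀` over a smooth irreducible
quasi-projective base, a global class with fibrewise rational `(k,k)` restrictions in `W_E ⊗ ℂ` (through the charts)
that is algebraic on ONE fibre is algebraic on EVERY fibre. An instance of Grothendieck's variational Hodge conjecture
(Charles–Schnell Conj. 11.3.1); WEAKER than R3var's slice (`…_of_weilVariationalHodgeCMField`); known in print for no
component with `e₀ ≥ 2`. ON-PATH `weilVariationalHodgeComponentCM_of_hodgeConjecture`.
[cite: CharlesSchnell2014Notes, Conj. 11.3.1 (p. 477)] [cite: Deligne1982HodgeCycles, §4 proof of Thm. 4.8] [status: open] -/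
@[conjecture] def WeilVariationalHodgeComponentCM : Prop :=
  ∀ ⦃𝒳 S : SchemeOver ℂ⦄ (f : 𝒳 ⟶ S), IsSmoothProjectiveFamily f (2 * k * e₀) →
    IsQuasiProjectiveOver 𝒳 → IsQuasiProjectiveOver S → IrreducibleSpace S.left →
    AlgebraicGeometry.Smooth S.hom →
    ∀ (W : complexBetti 𝒳 (2 * k)),
      (∀ s : ComplexPoints S,
        IsRationalClass (complexBetti.map (fiberι f s) (2 * k) W) ∧
          IsOfHodgeType (2 * k * e₀) (fiberOver f s) (2 * k) k k (complexBetti.map (fiberι f s) (2 * k) W)) →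
      HasWeilChartsOfDiscCM R e₀ k δ f W →
      (∃ s₀ : ComplexPoints S,
        complexBetti.map (fiberι f s₀) (2 * k) W ∈ algebraicClasses (fiberOver f s₀) k) →
      ∀ s : ComplexPoints S,
        complexBetti.map (fiberι f s) (2 * k) W ∈ algebraicClasses (fiberOver f s) k

/-- **`PointedWeilFamiliesComponentCM R e₀ k δ anchor` — family supply on the component with an ABSTRACT anchor
(schema).** For `(A, η, h)` as in `WeilClassesComponentCM R e₀ k δ` and a rational `(k,k)` class `c ≠ 0` of `W_E ⊗ ℂ`:
a smooth projective `(E, 2k, δ)`-Weil family through `A` (chart `ι : A.X ≅ 𝒳_{s₁}`), a global class `W` fibrewise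
rational of type `(k,k)` reading `c` at `s₁`, and `anchor 𝒳_{s₀} (W|_{𝒳_{s₀}})` at a marked fibre. In print ONE
construction (Deligne, proof of Thm. 4.8 (a)–(c): the family over the Hermitian symmetric domain of `(E, φ)`, global
invariant cycles, a CM point — dense by Mumford 1969 §3 — resp. a member isogenous to a power of a CM abelian variety).
[cite: Deligne1982HodgeCycles, §4 proof of Thm. 4.8 (a)–(c) and §5] [cite: Mumford1969NoteShimura, §3] -/
def PointedWeilFamiliesComponentCM (anchor : (X : SchemeOver ℂ) → complexBetti X (2 * k) → Prop) : Prop :=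
  ∀ (A : AbelianVariety ℂ) (η : A ⟶ A) (h : complexBetti A.X 2), IsWeilTypeCM A η R e₀ k →
    IsPolarizationClass A.dim A.X h →
    (∀ x y : complexBetti A.X 1,
      polarizationPairingOne A.X h (A.dim - 1) (pullbackOne A η x) y =
        -polarizationPairingOne A.X h (A.dim - 1) x (pullbackOne A η y)) →
    HasWeilDiscriminantCM A η R e₀ k h δ →
    ∀ c ∈ weilClassesField A η (R.comp (Polynomial.X ^ 2)) (2 * k), IsRationalClass c →
      IsOfHodgeType A.dim A.X (2 * k) k k c → c ≠ 0 →
      ∃ (𝒳 S : SchemeOver ℂ) (f : 𝒳 ⟶ S) (s₁ s₀ : ComplexPoints S) (ι : A.X ≅ fiberOver f s₁)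
          (W : complexBetti 𝒳 (2 * k)),
        IsSmoothProjectiveFamily f (2 * k * e₀) ∧ IsQuasiProjectiveOver 𝒳 ∧ IsQuasiProjectiveOver S ∧
        IrreducibleSpace S.left ∧ AlgebraicGeometry.Smooth S.hom ∧
        (∀ s : ComplexPoints S,
          IsRationalClass (complexBetti.map (fiberι f s) (2 * k) W) ∧
            IsOfHodgeType (2 * k * e₀) (fiberOver f s) (2 * k) k k (complexBetti.map (fiberι f s) (2 * k) W)) ∧
        HasWeilChartsOfDiscCM R e₀ k δ f W ∧
        complexBetti.map ι.hom (2 * k) (complexBetti.map (fiberι f s₁) (2 * k) W) = c ∧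
        anchor (fiberOver f s₀) (complexBetti.map (fiberι f s₀) (2 * k) W)

end Indexed

/-- The CM anchor in fibre dimension `g`, class degree `2p`: the marked fibre is presented by a CM abelian variety of
dimension `g`. (`cmAnchorOfDim (2 * n) n = cmAnchor n`, `rfl`.) [cite: Mumford1969NoteShimura, §3] -/
def cmAnchorOfDim (g p : ℕ) (X : SchemeOver ℂ) (_x : complexBetti X (2 * p)) : Prop :=
  ∃ A₀ : AbelianVariety ℂ, Nonempty (A₀.X ≅ X) ∧ A₀.dim = g ∧ IsOfCMType A₀

/-- The divisor-generated CM anchor in fibre dimension `g`: a CM chart `A₀` of dimension `g` all of whose rational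
`(p,p)` classes are polynomials in divisor classes (in print: a member isogenous to a power `Bᵐ` of a CM abelian variety
with `Hdg = Div`, e.g. `B = E_K` or Hazama–Murty non-degenerate CM types). (`… (2 * n) n = divisorGeneratedCMAnchor n`,
`rfl`.) [cite: Deligne1982HodgeCycles, §5] -/
def divisorGeneratedCMAnchorOfDim (g p : ℕ) (X : SchemeOver ℂ) (_x : complexBetti X (2 * p)) : Prop :=
  ∃ A₀ : AbelianVariety ℂ, Nonempty (A₀.X ≅ X) ∧ A₀.dim = g ∧ IsOfCMType A₀ ∧
    ∀ y : complexBetti A₀.X (2 * p), IsRationalClass y → IsOfHodgeType A₀.dim A₀.X (2 * p) p p y →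
      y ∈ divisorClassesSpan A₀.X A₀.dim p

/-- Dictionary to part VII-A: the quadratic anchors are the `g = 2n` instances. [folklore] -/
theorem cmAnchorOfDim_two_mul (n : ℕ) : cmAnchorOfDim (2 * n) n = cmAnchor n := rfl

/-- Dictionary to part VII-A (divisor-generated CM anchor). [folklore] -/
theorem divisorGeneratedCMAnchorOfDim_two_mul (n : ℕ) :
    divisorGeneratedCMAnchorOfDim (2 * n) n = divisorGeneratedCMAnchor n := rfl

section Leaves

variable (R : Polynomial ℤ) [Fact (Irreducible (realPolyQ R))] (e₀ k : ℕ) (δ : cmNormResidueGroup R)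

/-- **`CMPointedWeilFamiliesComponentCM` — CM-pointed `(E, 2k, δ)`-Weil families (typed missing input; a family-SUPPLY
hypothesis met in print — Deligne's family of Thm. 4.8 with a CM point, Mumford 1969 §3 — NOT a case of HC, hence no
on-path lemma).** [cite: Deligne1982HodgeCycles, §4 proof of Thm. 4.8 (a)–(c) and §5] [cite: Mumford1969NoteShimura, §3]
[status: open] -/
@[conjecture] def CMPointedWeilFamiliesComponentCM : Prop :=
  PointedWeilFamiliesComponentCM R e₀ k δ (cmAnchorOfDim (2 * k * e₀) k)

/-- **`AnchoredWeilFamiliesComponentCM` — the component's anchored leaf (R3anc cut down to `(E, 2k, δ)`; typed missing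
input; a CASE of the summit, `anchoredWeilFamiliesComponentCM_of_hodgeConjecture`).** No anchor mechanism is in print
for `e₀ ≥ 2` beyond CM / isogenous-to-a-power members. [cite: Markman2025SurveySecant, §12 (preprint, unrefereed)]
[status: open] -/
@[conjecture] def AnchoredWeilFamiliesComponentCM : Prop :=
  PointedWeilFamiliesComponentCM R e₀ k δ (algebraicAnchor k)

/-- **`DivisorGeneratedCMPointedWeilFamiliesComponentCM` — CM-pointed `(E, 2k, δ)`-Weil families whose CM fibre is
divisor-generated (typed missing input; the `HC_CM`-FREE family leaf).** In print: Deligne §5 — every component of the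
moduli of polarized abelian varieties of Weil type relative to `E` contains members isogenous to powers of CM abelian
varieties, among them products with `Hdg = Div`; kept typed. [cite: Deligne1982HodgeCycles, §5] [status: open] -/
@[conjecture] def DivisorGeneratedCMPointedWeilFamiliesComponentCM : Prop :=
  PointedWeilFamiliesComponentCM R e₀ k δ (divisorGeneratedCMAnchorOfDim (2 * k * e₀) k)

/-- **T6(δ)-CM — the general member of the component `(E, 2k, δ)` (typed target; a CASE of the summit).** For `(A, η, h)`
on the component with Hodge group `SU(V, φ)` (`HasHodgeGroupSUCM`), the Hodge conjecture holds for `A` in every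
codimension. Row T6-CM of the transport file cut down to one component. [cite: Deligne1982HodgeCycles, §4 (4.4), Prop. 4.4 and Milne 2003 re-edition endnote 16]
[status: open] -/
@[conjecture] def HodgeGeneralWeilTypeComponentCM : Prop :=
  ∀ (A : AbelianVariety ℂ) (η : A ⟶ A) (h : complexBetti A.X 2), IsWeilTypeCM A η R e₀ k →
    IsPolarizationClass A.dim A.X h →
    (∀ x y : complexBetti A.X 1,
      polarizationPairingOne A.X h (A.dim - 1) (pullbackOne A η x) y =
        -polarizationPairingOne A.X h (A.dim - 1) x (pullbackOne A η y)) →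
    HasWeilDiscriminantCM A η R e₀ k h δ →
    HasHodgeGroupSUCM A η (R.comp (Polynomial.X ^ 2)) h → HodgeConjectureFor A.dim A.X

end Leaves

/-- **`WeilClassesByComponentCM` — every component: every `R` with `F = ℚ[S]/(R)` a field, every `e₀ ≥ 2`, `k`, `δ`.**
Implied by `WeilClassesWeilTypeCM` and EQUIVALENT to it granted `PolarizedWeilDiscriminantCMExists` (§3).
[cite: Deligne1982HodgeCycles, §4 p. 30 (1) and Lemma 4.6] [status: open] -/
@[conjecture] def WeilClassesByComponentCM : Prop :=
  ∀ (R : Polynomial ℤ) [Fact (Irreducible (realPolyQ R))] (e₀ k : ℕ) (δ : cmNormResidueGroup R), 2 ≤ e₀ →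
    WeilClassesComponentCM R e₀ k δ

/-- **`PolarizedWeilDiscriminantCMExists` — Deligne §4 p. 30 (1) with Lemma 4.6 and hypothesis (a) of Thm. 4.8, typed on
the carriers (kept as a named hypothesis, NEVER cited as a fact).** Every Weil-type CM datum `(A, η, R, e₀, k)` carries
SOME polarization class `h` whose Rosati involution induces complex conjugation on `E` together with discriminant data of
SOME class `δ ∈ Fˣ/Nm(Eˣ)`: Lemma 4.6 produces the `E`-Hermitian `φ` with `ψ = Tr_{E/ℚ}(f φ)` from any Riemann form
`ψ` once (a) holds, and (1) gives `disc φ ∈ Fˣ/Nm Eˣ` for non-degenerate `φ`. The EXISTENCE of a polarization with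
(a) is ASSUMED in Thm. 4.8 and supplied in §5 for CM abelian varieties; its carrier rendering (hard-Lefschetz
non-degeneracy of `Q_h` on `H¹`, rationality of the `c_{abj}`, the trace characterisation of `Φ`) is not proved in the
tree. OPEN as a formal statement (obligation node for a Literature seat). [cite: Deligne1982HodgeCycles, §4 p. 30 (1), Lemma 4.6, Sublemma 4.7, Thm. 4.8 (a) and §5]
[status: open] -/
@[conjecture] def PolarizedWeilDiscriminantCMExists : Prop :=
  ∀ (R : Polynomial ℤ) [Fact (Irreducible (realPolyQ R))] (A : AbelianVariety ℂ) (η : A ⟶ A) (e₀ k : ℕ),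
    IsWeilTypeCM A η R e₀ k →
      ∃ (h : complexBetti A.X 2) (δ : cmNormResidueGroup R),
        IsPolarizationClass A.dim A.X h ∧
          (∀ x y : complexBetti A.X 1,
            polarizationPairingOne A.X h (A.dim - 1) (pullbackOne A η x) y =
              -polarizationPairingOne A.X h (A.dim - 1) x (pullbackOne A η y)) ∧
          HasWeilDiscriminantCM A η R e₀ k h δ

/-! ### §2 The rows: anchor engine, anchor validity, W1-CM / W1′-CM / anchored -/

section Rows

variable {R : Polynomial ℤ} [Fact (Irreducible (realPolyQ R))] {e₀ k : ℕ} {δ : cmNormResidueGroup R}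

/-- A pointed leaf with a STRONGER anchor implies the pointed leaf with a weaker one. [folklore] -/
theorem PointedWeilFamiliesComponentCM.mono {P Q : (X : SchemeOver ℂ) → complexBetti X (2 * k) → Prop}
    (hPQ : ∀ X x, P X x → Q X x) (hP : PointedWeilFamiliesComponentCM R e₀ k δ P) :
    PointedWeilFamiliesComponentCM R e₀ k δ Q := by
  intro A η h hW hpol hRos hδ c hc hcQ hcH hc0
  obtain ⟨𝒳, S, f, s₁, s₀, ι, W, hf, h𝒳, hS, hirrS, hsm, hWs, hch, hread, hanch⟩ :=
    hP A η h hW hpol hRos hδ c hc hcQ hcH hc0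
  exact ⟨𝒳, S, f, s₁, s₀, ι, W, hf, h𝒳, hS, hirrS, hsm, hWs, hch, hread, hPQ _ _ hanch⟩

/-- **ANCHOR ENGINE of the component `(E, 2k, δ)` (abstract anchor).** If the anchor predicate makes rational `(k,k)`
classes algebraic on the marked fibre (ambient dimension `2k·e₀`), then pointed `(E, 2k, δ)`-Weil families and the
δ-restricted Weil-confined variational Hodge statement give the class target of the component.
[cite: Deligne1982HodgeCycles, §4 proof of Thm. 4.8 (strategy)] [cite: CharlesSchnell2014Notes, Conj. 11.3.1] -/
theorem weilClassesComponentCM_of_pointed_of_variational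
    {anchor : (X : SchemeOver ℂ) → complexBetti X (2 * k) → Prop}
    (hvalid : ∀ (X : SchemeOver ℂ) (x : complexBetti X (2 * k)), anchor X x → IsRationalClass x →
      IsOfHodgeType (2 * k * e₀) X (2 * k) k k x → x ∈ algebraicClasses X k)
    (hP : PointedWeilFamiliesComponentCM R e₀ k δ anchor) (hV : WeilVariationalHodgeComponentCM R e₀ k δ) :
    WeilClassesComponentCM R e₀ k δ := by
  intro A η h hW hpol hRos hδ c hc hcQ hcH
  by_cases hc0 : c = 0
  · rw [hc0]; exact Submodule.zero_mem _
  obtain ⟨𝒳, S, f, s₁, s₀, ι, W, hf, h𝒳, hS, hirrS, hsm, hWs, hch, hread, hanch⟩ :=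
    hP A η h hW hpol hRos hδ c hc hcQ hcH hc0
  haveI := hirrS
  have hs₀ : complexBetti.map (fiberι f s₀) (2 * k) W ∈ algebraicClasses (fiberOver f s₀) k :=
    hvalid _ _ hanch (hWs s₀).1 (hWs s₀).2
  have h1 : complexBetti.map (fiberι f s₁) (2 * k) W ∈ algebraicClasses (fiberOver f s₁) k :=
    hV f hf h𝒳 hS hirrS hsm W hWs hch ⟨s₀, hs₀⟩ s₁
  rw [← hread]
  exact (mem_algebraicClasses_map_iff_of_iso ι).2 h1

/-- Under `HC_CM` the CM anchor is valid in every fibre dimension `g` (`Ring2Transport.mem_algebraicClasses_of_cmChart`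
— the ONLY place `HC_CM` is consumed in this file). [cite: Milne1999, §7 p. 72] -/
theorem cmAnchorOfDim_valid_of_HC_CM (hCM : Theses.RankFourFaces.CMAbelianHodge) (g p : ℕ) :
    ∀ (X : SchemeOver ℂ) (x : complexBetti X (2 * p)), cmAnchorOfDim g p X x → IsRationalClass x →
      IsOfHodgeType g X (2 * p) p p x → x ∈ algebraicClasses X p := by
  rintro X x ⟨A₀, ⟨e₀⟩, hA₀dim, hA₀cm⟩ hxQ hxH
  exact mem_algebraicClasses_of_cmChart hCM A₀ e₀ hA₀dim hA₀cm hxQ hxH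

/-- The divisor-generated CM anchor is valid WITHOUT `HC_CM` (Lefschetz (1,1) and products on the chart,
`Ring2Transport.divisorClassesSpan_le_algebraicClasses_dim`, transported along the chart). [cite: Deligne1982HodgeCycles, §5] -/
theorem divisorGeneratedCMAnchorOfDim_valid (g p : ℕ) :
    ∀ (X : SchemeOver ℂ) (x : complexBetti X (2 * p)), divisorGeneratedCMAnchorOfDim g p X x → IsRationalClass x →
      IsOfHodgeType g X (2 * p) p p x → x ∈ algebraicClasses X p := by
  rintro X x ⟨A₀, ⟨e₀⟩, hA₀dim, -, hdiv⟩ hxQ hxH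
  have hx' : complexBetti.map e₀.hom (2 * p) x ∈ algebraicClasses A₀.X p := by
    refine divisorClassesSpan_le_algebraicClasses_dim A₀ p (hdiv _ ((isRationalClass_map_iff_of_iso e₀).2 hxQ) ?_)
    rw [hA₀dim]
    exact (isOfHodgeType_map_iff_of_iso e₀).2 hxH
  exact (mem_algebraicClasses_map_iff_of_iso e₀).1 hx'

/-- The algebraic anchor is valid by definition (any ambient dimension). [folklore] -/
theorem algebraicAnchor_valid' (g p : ℕ) :
    ∀ (X : SchemeOver ℂ) (x : complexBetti X (2 * p)), algebraicAnchor p X x → IsRationalClass x →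
      IsOfHodgeType g X (2 * p) p p x → x ∈ algebraicClasses X p :=
  fun _ _ hx _ _ => hx

/-- **Row W1-CM — the class target of the component `(E, 2k, δ)` from `HC_CM`, CM-pointed δ-families and the
δ-restricted Weil-confined variational Hodge statement.** CONDITIONAL on the three named hypotheses; ON-PATH lemma of
the target: `weilClassesComponentCM_of_hodgeConjecture`. HONEST COLUMN: `HC_CM` is NOMINAL (row W1′-CM); the content is
`WeilVariationalHodgeComponentCM R e₀ k δ`, OPEN. [cite: Deligne1982HodgeCycles, §4 proof of Thm. 4.8 (a)–(c)]
[cite: CharlesSchnell2014Notes, Conj. 11.3.1] -/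
theorem weilClassesComponentCM_of_HC_CM (hCM : Theses.RankFourFaces.CMAbelianHodge)
    (hP : CMPointedWeilFamiliesComponentCM R e₀ k δ) (hV : WeilVariationalHodgeComponentCM R e₀ k δ) :
    WeilClassesComponentCM R e₀ k δ :=
  weilClassesComponentCM_of_pointed_of_variational (cmAnchorOfDim_valid_of_HC_CM hCM _ _) hP hV

/-- **Row W1′-CM — the same target WITHOUT `HC_CM`**, from δ-families pointed at a divisor-generated CM fibre.
[cite: Deligne1982HodgeCycles, §5] [cite: CharlesSchnell2014Notes, Conj. 11.3.1] -/
theorem weilClassesComponentCM_of_divisorGeneratedCMPointed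
    (hP : DivisorGeneratedCMPointedWeilFamiliesComponentCM R e₀ k δ) (hV : WeilVariationalHodgeComponentCM R e₀ k δ) :
    WeilClassesComponentCM R e₀ k δ :=
  weilClassesComponentCM_of_pointed_of_variational (divisorGeneratedCMAnchorOfDim_valid _ _) hP hV

/-- **Anchored row — the target from the component's anchored leaf and its δ-VHC** (both cases of the summit).
[cite: CharlesSchnell2014Notes, Conj. 11.3.1] -/
theorem weilClassesComponentCM_of_anchored_of_variational (hP : AnchoredWeilFamiliesComponentCM R e₀ k δ)
    (hV : WeilVariationalHodgeComponentCM R e₀ k δ) : WeilClassesComponentCM R e₀ k δ :=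
  weilClassesComponentCM_of_pointed_of_variational (algebraicAnchor_valid' _ _) hP hV

/-- The divisor-generated CM-pointed leaf implies the CM-pointed leaf. [folklore] -/
theorem cmPointedWeilFamiliesComponentCM_of_divisorGenerated
    (hP : DivisorGeneratedCMPointedWeilFamiliesComponentCM R e₀ k δ) : CMPointedWeilFamiliesComponentCM R e₀ k δ :=
  PointedWeilFamiliesComponentCM.mono (fun _ _ ⟨A₀, hA₀, hdim, hcm, _⟩ => ⟨A₀, hA₀, hdim, hcm⟩) hP

/-- Under `HC_CM`, a CM-pointed δ-family is an anchored δ-family. [cite: Deligne1982HodgeCycles, §4 proof of Thm. 4.8 (a)–(c)] -/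
theorem anchoredWeilFamiliesComponentCM_of_HC_CM_of_cmPointed (hCM : Theses.RankFourFaces.CMAbelianHodge)
    (hP : CMPointedWeilFamiliesComponentCM R e₀ k δ) : AnchoredWeilFamiliesComponentCM R e₀ k δ := by
  intro A η h hW hpol hRos hδ c hc hcQ hcH hc0
  obtain ⟨𝒳, S, f, s₁, s₀, ι, W, hf, h𝒳, hS, hirrS, hsm, hWs, hch, hread, hanch⟩ :=
    hP A η h hW hpol hRos hδ c hc hcQ hcH hc0
  exact ⟨𝒳, S, f, s₁, s₀, ι, W, hf, h𝒳, hS, hirrS, hsm, hWs, hch, hread,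
    cmAnchorOfDim_valid_of_HC_CM hCM _ _ _ _ hanch (hWs s₀).1 (hWs s₀).2⟩

end Rows

end Summit.HodgeConjecture.HodgeConjecture.Ring2.Hypotheses

end
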